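import Literature.AlgebraicGeometry.Motives.HodgeDecomposition
import Literature.NumberTheory.Transcendental.ComplexFormsProofs
import Literature.NumberTheory.Transcendental.ComplexFormsSmoothProofs
import Literature.NumberTheory.Transcendental.DolbeaultProofs
import Literature.NumberTheory.Transcendental.DolbeaultIntegrabilityProofs
import Literature.NumberTheory.Transcendental.KaehlerHodgeConjProofs
import Literature.NumberTheory.Transcendental.KaehlerHodgeDolbeaultHarmonicProofs
import Literature.NumberTheory.Transcendental.KaehlerHodgeDelLaplacianFact
import HarnessLib

/-!
# `ℋ^{p,q} → H^{p,q}`: `∂̄`-harmonic `(p,q)`-forms on a compact Kähler manifold are `d`-closed — proofs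

Trunk **T-KAEHLER** (`AlgebraicGeometry/Motives`). Theorems-only companion of
`Literature/AlgebraicGeometry/Motives/HodgeDecomposition.lean`, about its named fact
`Literature.AlgebraicGeometry.Motives.mk_mem_hodgePQ_of_mem_dolbeaultHarmonicForms` (**hodge.S07**,
converse inclusion `ℋ^{p,q} → H^{p,q} = K^{p,q}`): on a compact Kähler manifold `(M, g)` a
`∂̄`-harmonic form of type `(p,q)` is `d`-closed, so its complex de Rham class lies in the span
`hodgePQ E M k p q` of classes of closed `(p,q)`-forms (Voisin's `K^{p,q}`).

## The printed proof (Voisin (2002), §5.1.2 and §6.1.2–6.1.3, PDF pp. 108, 120–121)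

* Thm. 6.7 (p. 120): on a Kähler manifold `Δ_∂ = Δ_∂̄ = ½ Δ_d`; Cor. 6.10 (pp. 120–121): the
  `Δ_d`-harmonic `(p,q)`-forms are the `Δ_∂̄`-harmonic ones.
* Lemma 5.12 / Cor. 5.13 (p. 108): on a compact manifold `Ker Δ = Ker d ∩ Ker d*` "and the
  analogous equalities for the other Laplacians" (`Δ_∂`, `Δ_∂̄`).
* Prop. 6.11, proof (p. 121): `K^{p,q} ⊂ H^k(X, ℂ)` is the subspace of classes representable by a
  closed form of type `(p,q)`; "obviously `H^{p,q} ⊂ K^{p,q}`" (a harmonic form is closed).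

## What is proved here, and on what it rests

The two deep inputs exist upstream as (undischarged) named facts of
`Literature/NumberTheory/Transcendental/KaehlerHodge.lean` (C12), both stated for the smooth
metric term `g`:

* `Literature.NumberTheory.Transcendental.dolbeaultHarmonicForms_le_dolbeaultClosedForms g o`
  (`ℋ^{p,q} ≤ Z^{p,q}_{∂̄}` on a compact Hermitian manifold: Cor. 5.13 for `Δ_∂̄`), and
* `Literature.NumberTheory.Transcendental.dolbeaultHarmonicForms_conj g o`
  (`\overline{ℋ^{p,q}} = ℋ^{q,p}` on a Kähler manifold: Thm. 6.7, `Δ_∂̄ = Δ_∂ = \overline{Δ_∂̄ \overline{·}}`).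

From these the fact follows by the algebra of `∂`, `∂̄` and conjugation already *proved* in C9/C10
(`dolbeault_conj` with `typeComponent_conj_holds`, `mextDeriv_conj_holds`; `d = ∂ + ∂̄`,
`mextDeriv_eq_dolbeault_add_dolbeaultBar_holds`; `mem_dolbeaultClosedForms_iff` with
`isSmoothForm_typeComponent_holds`, `dolbeaultBar_smul_holds`): if `α ∈ ℋ^{p,q}` then `∂̄α = 0`,
and `ᾱ ∈ ℋ^{q,p}` gives `∂̄ᾱ = 0`, i.e. `∂α = \overline{∂̄ᾱ} = 0`, whence `dα = ∂α + ∂̄α = 0`.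
This is the **relative discharge**
`mk_mem_hodgePQ_of_mem_dolbeaultHarmonicForms_of (h₁ : … le_dolbeaultClosedForms …) (h₂ : … conj …)`;
the closed discharge `mk_mem_hodgePQ_of_mem_dolbeaultHarmonicForms_holds` is then the one-liner
feeding it the two upstream discharges, once they exist (in the form
`by intro _ _ _ hg; exact mk_mem_hodgePQ_of_mem_dolbeaultHarmonicForms_of g o h₁ h₂ hg`, so that
upstream discharges binding the holomorphic-atlas instance can be used for `h₁`, `h₂` after the
first `intro`). No new named fact is introduced (D-0026); nothing here is deep.

*Remark on the upstream statements.* The two C12 facts are `def … : Prop` written after a section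
`variable [IsManifold 𝓘(ℂ, E) ω M]` which their bodies do not use, so (like
`isSmoothForm_typeComponent`, cf. `ComplexFormsSmoothProofs.lean`) the `Prop`s themselves carry
no holomorphic-atlas hypothesis; the hypotheses `h₁`, `h₂` below are these `Prop`s *at a complex
manifold* `M` (the instance is bound by the fact being proved), which is where they are true and
where their eventual discharges (with the instance as an instance argument, as for
`isSmoothForm_typeComponent_holds`) apply.

## Reduction of `h₂` to the Kähler identities proper

The second input is itself a formal consequence of either Kähler identity of C12 —
`Literature.NumberTheory.Transcendental.dolbeaultLaplacian_eq_delLaplacian g o` (`Δ_∂̄ = Δ_∂`) or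
`Literature.NumberTheory.Transcendental.cHodgeLaplacian_eq_two_smul_dolbeaultLaplacian g o`
(`Δ_d = 2Δ_∂̄`), Voisin (2002), Thm. 6.7 — by the algebraic intertwining
`Δ_∂̄ ᾱ = \overline{Δ_∂ α}`, `Δ_d ᾱ = \overline{Δ_d α}` proved in
`Literature/NumberTheory/Transcendental/KaehlerHodgeConjProofs.lean`
(`dolbeaultHarmonicForms_conj_of_dolbeaultLaplacian_eq_delLaplacian`,
`dolbeaultHarmonicForms_conj_of_cHodgeLaplacian_eq_two_smul_dolbeaultLaplacian`; Huybrechts (2005),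
Remarks 3.2.7 i), PDF p. 151: on a Kähler manifold "complex conjugation interchanges
`ℋ^{p,q}_∂̄(X,g)` and `ℋ^{q,p}_∂̄(X,g)`"). Hence the variants
`mk_mem_hodgePQ_of_mem_dolbeaultHarmonicForms_of_dolbeaultLaplacian_eq_delLaplacian` and
`mk_mem_hodgePQ_of_mem_dolbeaultHarmonicForms_of_cHodgeLaplacian_eq_two_smul_dolbeaultLaplacian`,
resting on `dolbeaultHarmonicForms_le_dolbeaultClosedForms` and one Kähler identity only: the
closed discharge `mk_mem_hodgePQ_of_mem_dolbeaultHarmonicForms_holds` is one line from the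
discharges of `dolbeaultHarmonicForms_le_dolbeaultClosedForms` (Voisin Cor. 5.13 for `Δ_∂̄`) and of
either Kähler identity (Voisin Thm. 6.7), none of which is in the tree yet.

## `h₁` discharged at a complex manifold; what remains is one Kähler identity (update)

Since the above was written the tree acquired Voisin's Lemma 5.8 (`∂̄*` is the `L²`-adjoint of
`∂̄`: `MForm.cl2Inner_dolbeaultBar_left_of_isHermitian`, `KaehlerHodgeAdjointProofs.lean`) and
Cor. 5.13 for `Δ_∂̄` in positive degree (`isDolbeaultHarmonic_iff_of_inner_tangentJ`,
`KaehlerHodgeDolbeaultHarmonicProofs.lean`), both *proved* for a holomorphic atlas. Section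
`Closed` below uses them to prove the first input outright at a complex manifold:
`dolbeaultBar_eq_zero_of_isDolbeaultHarmonic` (all degrees; for functions the printed argument
`‖∂̄f‖² = ⟪f, ∂̄*∂̄f⟫ = ⟪f, Δ_∂̄ f⟫ = 0`, Voisin (2002), Lemma 5.12 / Cor. 5.13, is carried out here)
and `dolbeaultHarmonicForms_le_dolbeaultClosedForms_of_isManifold_complex :
dolbeaultHarmonicForms_le_dolbeaultClosedForms g o` (the C12 `Prop` at a complex `M`, where it is
true; over general real atlases that `Prop` fails like its siblings, cf. the module docstring of
`KaehlerHodgeDolbeaultHarmonicProofs.lean`). Consequently the named fact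
`mk_mem_hodgePQ_of_mem_dolbeaultHarmonicForms g o` is reduced, with proof, to **one** remaining
input, Voisin's Thm. 6.7 at this complex manifold, in any of the three forms the tree names:
`mk_mem_hodgePQ_of_mem_dolbeaultHarmonicForms_of_laplacian_comparison`
(`Δ_d = 2Δ_∂̄`: `cHodgeLaplacian_eq_two_smul_dolbeaultLaplacian_of_isManifold_complex g o`),
`mk_mem_hodgePQ_of_mem_dolbeaultHarmonicForms_of_dolbeaultLaplacian_eq_delLaplacian'`
(`Δ_∂̄ = Δ_∂`: `dolbeaultLaplacian_eq_delLaplacian_of_isManifold_complex g o`) and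
`mk_mem_hodgePQ_of_mem_dolbeaultHarmonicForms_of_kaehlerIdentities` (the first-order Kähler
identities `KaehlerIdentities o Λ` of `KaehlerHodgeLaplacianProofs.lean` for some contraction
family `Λ`, Voisin (2002), Prop. 6.5). The closed discharge
`mk_mem_hodgePQ_of_mem_dolbeaultHarmonicForms_holds` is `…_of_laplacian_comparison g o
(fun {k m} ↦ cHodgeLaplacian_eq_two_smul_dolbeaultLaplacian_of_isManifold_complex_holds g o)` the
moment that discharge (Voisin, Thm. 6.7 = Prop. 6.5 + Lemma 6.6) lands; none of the Kähler
identities is in the tree yet, and none is restated here (D-0026).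

## References

* C. Voisin, *Hodge Theory and Complex Algebraic Geometry I* (2002), Lemma 5.12, Cor. 5.13
  (PDF p. 108), Thm. 6.7, Cor. 6.10 (PDF p. 120), §6.1.3 Prop. 6.11 (PDF p. 121). [Voisin2002]
* D. Huybrechts, *Complex Geometry* (2005), Prop. 3.1.12, Remarks 3.2.7 i), Cor. 3.2.12
  (held; PDF pp. 145, 151, 154). [Huybrechts2005]
-/

noncomputable section

open scoped Manifold ContDiff Topology ComplexConjugate
open Bundle Module Set Finset

namespace Literature.AlgebraicGeometry.Motives

open Literature.Geometry.Kaehler Literature.NumberTheory.Transcendental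

variable {E : Type*} [NormedAddCommGroup E] [NormedSpace ℂ E]
  {M : Type*} [TopologicalSpace M] [ChartedSpace E M]
  [FiniteDimensional ℂ E] [IsManifold 𝓘(ℝ, E) ∞ M] {n : ℕ} [Fact (finrank ℝ E = n)]
  (g : ContMDiffRiemannianMetric 𝓘(ℝ, E) ∞ E (fun x : M ↦ TangentSpace 𝓘(ℝ, E) x))
  (o : (x : M) → Orientation ℝ (TangentSpace 𝓘(ℝ, E) x) (Fin n))

/-- **`∂̄`-harmonic `(p,q)`-forms are smooth, of type `(p,q)` and `∂̄`-closed** on a compact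
Hermitian manifold, in degree `p + q`: unpacking of the C12 named fact
`dolbeaultHarmonicForms_le_dolbeaultClosedForms` (hypothesis `h₁`; Voisin (2002), Cor. 5.13 for
`Δ_∂̄`, PDF p. 108) through C10's `mem_dolbeaultClosedForms_iff` (the span `Z^{p,q}_{∂̄}` adds
nothing on a complex manifold). [cite: Voisin2002, Cor. 5.13] -/
theorem isSmoothForm_and_isOfType_and_dolbeaultBar_eq_zero_of_mem_dolbeaultHarmonicForms
    [IsManifold 𝓘(ℂ, E) ω M] [CompactSpace M] [T2Space M]
    (h₁ : ∀ {m : ℕ}, dolbeaultHarmonicForms_le_dolbeaultClosedForms (m := m) g o)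
    (hg : g.toRiemannianMetric.IsHermitian) {p q m : ℕ} (h : (p + q) + m = n)
    {α : MForm 𝓘(ℝ, E) M ℂ (p + q)} :
    letI : RiemannianBundle (fun x : M ↦ TangentSpace 𝓘(ℝ, E) x) := ⟨g.toRiemannianMetric⟩
    IsSmoothForm (riemannianVolumeForm o) → α ∈ dolbeaultHarmonicForms o p q h →
      IsSmoothForm α ∧ IsOfType p q α ∧ dolbeaultBar α = 0 := by
  intro ho hα
  exact (mem_dolbeaultClosedForms_iff (fun {k} ↦ isSmoothForm_typeComponent_holds)
    dolbeaultBar_smul_holds α).1 (h₁ hg h ho hα)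

/-- Degree-general form of
`isSmoothForm_and_isOfType_and_dolbeaultBar_eq_zero_of_mem_dolbeaultHarmonicForms`: the same for
`k`-forms with `p + q = k` (so that it applies to `ᾱ ∈ ℋ^{q,p}` inside the `(p+q)`-forms without a
degree cast). Voisin (2002), Cor. 5.13. [cite: Voisin2002, Cor. 5.13] -/
theorem dolbeaultBar_eq_zero_of_mem_dolbeaultHarmonicForms
    [IsManifold 𝓘(ℂ, E) ω M] [CompactSpace M] [T2Space M]
    (h₁ : ∀ {m : ℕ}, dolbeaultHarmonicForms_le_dolbeaultClosedForms (m := m) g o)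
    (hg : g.toRiemannianMetric.IsHermitian) {k p q m : ℕ} (hk : p + q = k) (h : k + m = n)
    {α : MForm 𝓘(ℝ, E) M ℂ k} :
    letI : RiemannianBundle (fun x : M ↦ TangentSpace 𝓘(ℝ, E) x) := ⟨g.toRiemannianMetric⟩
    IsSmoothForm (riemannianVolumeForm o) → α ∈ dolbeaultHarmonicForms o p q h →
      IsSmoothForm α ∧ IsOfType p q α ∧ dolbeaultBar α = 0 := by
  subst hk
  exact isSmoothForm_and_isOfType_and_dolbeaultBar_eq_zero_of_mem_dolbeaultHarmonicForms g o h₁ hg h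

/-- **`∂̄`-harmonic `(p,q)`-forms on a compact Kähler manifold are `d`-closed** (relative form).
From `ℋ^{p,q} ≤ Z^{p,q}_{∂̄}` (hypothesis `h₁`, the C12 fact
`dolbeaultHarmonicForms_le_dolbeaultClosedForms`; Voisin (2002), Cor. 5.13) and
`\overline{ℋ^{p,q}} = ℋ^{q,p}` (hypothesis `h₂`, the C12 fact `dolbeaultHarmonicForms_conj`;
Voisin (2002), Thm. 6.7 / Cor. 6.10): `∂̄α = 0` and `∂α = \overline{∂̄ᾱ} = 0`, so
`dα = ∂α + ∂̄α = 0` (`d = ∂ + ∂̄` on a complex manifold, C10). Voisin (2002), §6.1.2, Cor. 6.10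
with Cor. 5.13 (PDF pp. 108, 120–121). [cite: Voisin2002, Cor. 6.10] -/
theorem isClosedForm_of_mem_dolbeaultHarmonicForms
    [IsManifold 𝓘(ℂ, E) ω M] [CompactSpace M] [T2Space M]
    (h₁ : ∀ {m : ℕ}, dolbeaultHarmonicForms_le_dolbeaultClosedForms (m := m) g o)
    (h₂ : ∀ {k m : ℕ}, dolbeaultHarmonicForms_conj (k := k) (m := m) g o)
    (hg : g.toRiemannianMetric.IsKaehler) {k p q m : ℕ} (hk : p + q = k) (h : k + m = n)
    {α : MForm 𝓘(ℝ, E) M ℂ k} :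
    letI : RiemannianBundle (fun x : M ↦ TangentSpace 𝓘(ℝ, E) x) := ⟨g.toRiemannianMetric⟩
    IsSmoothForm (riemannianVolumeForm o) → α ∈ dolbeaultHarmonicForms o p q h →
      IsSmoothForm α ∧ IsOfType p q α ∧ IsClosedForm α := by
  intro ho hα
  letI : RiemannianBundle (fun x : M ↦ TangentSpace 𝓘(ℝ, E) x) := ⟨g.toRiemannianMetric⟩
  obtain ⟨hs, ht, hdb⟩ :=
    dolbeaultBar_eq_zero_of_mem_dolbeaultHarmonicForms g o h₁ hg.isHermitian hk h ho hα
  -- `ᾱ ∈ ℋ^{q,p}` (Kähler), hence `∂̄ᾱ = 0`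
  have hconj : α.conj ∈ dolbeaultHarmonicForms o q p h := by
    rw [← h₂ hg h p q ho]
    exact Submodule.mem_map_of_mem hα
  obtain ⟨-, -, hdb'⟩ :=
    dolbeaultBar_eq_zero_of_mem_dolbeaultHarmonicForms g o h₁ hg.isHermitian
      ((Nat.add_comm q p).trans hk) h ho hconj
  -- `∂α = \overline{∂̄ᾱ} = 0`
  have hd : dolbeault α = 0 := by
    have hc := dolbeault_conj (fun {k} ↦ typeComponent_conj_holds) mextDeriv_conj_holds α.conj
    rw [MForm.conj_conj] at hc
    rw [hc, hdb', MForm.conj_zero]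
  refine ⟨hs, ht, ?_⟩
  rw [IsClosedForm, mextDeriv_eq_dolbeault_add_dolbeaultBar_holds hs, hd, hdb, add_zero]

/-- **Relative discharge of `mk_mem_hodgePQ_of_mem_dolbeaultHarmonicForms`** (hodge.S07, converse
inclusion `ℋ^{p,q} → H^{p,q}`): on a compact Kähler manifold the de Rham class of a `∂̄`-harmonic
`(p,q)`-form lies in `hodgePQ E M k p q` (Voisin's `K^{p,q}`), *given* the two C12 named facts
`dolbeaultHarmonicForms_le_dolbeaultClosedForms g o` (`h₁`, Voisin (2002), Cor. 5.13 for `Δ_∂̄`)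
and `dolbeaultHarmonicForms_conj g o` (`h₂`, Voisin (2002), Thm. 6.7) in every degree. The form
is closed by `isClosedForm_of_mem_dolbeaultHarmonicForms` and of type `(p,q)`, so its class is a
generator of the span `hodgePQ`; if `p + q ≠ k` then `ℋ^{p,q} = ⊥` and the form is `0`.
Voisin (2002), §6.1.3, proof of Prop. 6.11 (PDF p. 121: "obviously `H^{p,q} ⊂ K^{p,q}`").
[cite: Voisin2002, §6.1.3 Prop. 6.11] -/
theorem mk_mem_hodgePQ_of_mem_dolbeaultHarmonicForms_of
    (h₁ : ∀ {m : ℕ}, dolbeaultHarmonicForms_le_dolbeaultClosedForms (m := m) g o)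
    (h₂ : ∀ {k m : ℕ}, dolbeaultHarmonicForms_conj (k := k) (m := m) g o) :
    mk_mem_hodgePQ_of_mem_dolbeaultHarmonicForms g o := by
  intro _ _ _ hg k p q m h α ho hα
  letI : RiemannianBundle (fun x : M ↦ TangentSpace 𝓘(ℝ, E) x) := ⟨g.toRiemannianMetric⟩
  by_cases hpq : p + q = k
  · obtain ⟨hs, ht, hc⟩ := isClosedForm_of_mem_dolbeaultHarmonicForms g o h₁ h₂ hg hpq h ho hα
    exact ⟨mem_cclosedSmoothForms hs hc, Submodule.subset_span ⟨⟨α, _⟩, ht, rfl⟩⟩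
  · rw [dolbeaultHarmonicForms_eq_bot_of_ne o hpq h, Submodule.mem_bot] at hα
    subst hα
    refine ⟨zero_mem _, ?_⟩
    have h0 : (⟨0, zero_mem _⟩ : cclosedSmoothForms E M k) = 0 := rfl
    rw [h0, map_zero]
    exact zero_mem _


/-! ### Variants resting on a Kähler identity proper (`KaehlerHodgeConjProofs.lean`) -/

/-- **Relative discharge of `mk_mem_hodgePQ_of_mem_dolbeaultHarmonicForms`, variant via
`Δ_∂̄ = Δ_∂`**: on a compact Kähler manifold the de Rham class of a `∂̄`-harmonic `(p,q)`-form lies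
in `hodgePQ E M k p q`, *given* `ℋ^{p,q} ≤ Z^{p,q}_{∂̄}` in every degree (`h₁`, the C12 fact
`dolbeaultHarmonicForms_le_dolbeaultClosedForms g o`; Voisin (2002), Cor. 5.13 for `Δ_∂̄`) and the
Kähler identity `Δ_∂̄ = Δ_∂` in every degree (`hK`, the C12 fact
`dolbeaultLaplacian_eq_delLaplacian g o`; Voisin (2002), Thm. 6.7): by
`dolbeaultHarmonicForms_conj_of_dolbeaultLaplacian_eq_delLaplacian` (`KaehlerHodgeConjProofs.lean`)
and `mk_mem_hodgePQ_of_mem_dolbeaultHarmonicForms_of`. Voisin (2002), §6.1.3, proof of Prop. 6.11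
(PDF p. 121). [cite: Voisin2002, §6.1.3 Prop. 6.11] -/
theorem mk_mem_hodgePQ_of_mem_dolbeaultHarmonicForms_of_dolbeaultLaplacian_eq_delLaplacian
    (h₁ : ∀ {m : ℕ}, dolbeaultHarmonicForms_le_dolbeaultClosedForms (m := m) g o)
    (hK : ∀ {k m : ℕ}, dolbeaultLaplacian_eq_delLaplacian (k := k) (m := m) g o) :
    mk_mem_hodgePQ_of_mem_dolbeaultHarmonicForms g o :=
  mk_mem_hodgePQ_of_mem_dolbeaultHarmonicForms_of g o h₁
    fun {_ _} ↦ dolbeaultHarmonicForms_conj_of_dolbeaultLaplacian_eq_delLaplacian g o hK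

/-- **Relative discharge of `mk_mem_hodgePQ_of_mem_dolbeaultHarmonicForms`, variant via
`Δ_d = 2Δ_∂̄`** (Voisin's own route, Cor. 6.10: `ℋ^{p,q}` is the space of `(p,q)`-forms harmonic
for the real operator `Δ_d`): *given* `ℋ^{p,q} ≤ Z^{p,q}_{∂̄}` in every degree (`h₁`,
`dolbeaultHarmonicForms_le_dolbeaultClosedForms g o`; Voisin (2002), Cor. 5.13) and `Δ_d = 2Δ_∂̄` in
every degree (`hK`, the C12 fact `cHodgeLaplacian_eq_two_smul_dolbeaultLaplacian g o`; Voisin (2002),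
Thm. 6.7): by `dolbeaultHarmonicForms_conj_of_cHodgeLaplacian_eq_two_smul_dolbeaultLaplacian`
(`KaehlerHodgeConjProofs.lean`) and `mk_mem_hodgePQ_of_mem_dolbeaultHarmonicForms_of`.
Voisin (2002), §6.1.3, proof of Prop. 6.11 (PDF p. 121). [cite: Voisin2002, §6.1.3 Prop. 6.11] -/
theorem mk_mem_hodgePQ_of_mem_dolbeaultHarmonicForms_of_cHodgeLaplacian_eq_two_smul_dolbeaultLaplacian
    (h₁ : ∀ {m : ℕ}, dolbeaultHarmonicForms_le_dolbeaultClosedForms (m := m) g o)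
    (hK : ∀ {k m : ℕ}, cHodgeLaplacian_eq_two_smul_dolbeaultLaplacian (k := k) (m := m) g o) :
    mk_mem_hodgePQ_of_mem_dolbeaultHarmonicForms g o :=
  mk_mem_hodgePQ_of_mem_dolbeaultHarmonicForms_of g o h₁ fun {_ _} ↦
    dolbeaultHarmonicForms_conj_of_cHodgeLaplacian_eq_two_smul_dolbeaultLaplacian g o hK


/-! ### `ℋ^{p,q} ≤ Z^{p,q}_{∂̄}` at a complex manifold (Voisin, Cor. 5.13), and the reduced discharge -/

section Closed

variable [IsManifold 𝓘(ℂ, E) ω M]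

/-- **A `Δ_∂̄`-harmonic form on a compact Hermitian manifold is `∂̄`-closed** (Voisin (2002),
§5.1.4, Lemma 5.12 and Cor. 5.13, PDF p. 108: "`Ker Δ = Ker d ∩ Ker d*` and the analogous
equalities for the other Laplacians"; Huybrechts (2005), Lemma 3.2.5), for a holomorphic atlas, a
`C^∞` Riemannian metric on the real tangent bundle which is Hermitian at every point
(`hJ : ⟪Jv, Jw⟫ = ⟪v, w⟫`) and an orientation family with smooth volume form, in **every** degree
`k` (`h : k + m = n`): if `α` is `∂̄`-harmonic of type `(p,q)` (`IsDolbeaultHarmonic`: smooth, of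
type `(p,q)`, `Δ_∂̄ α = 0`) then `∂̄α = 0`. In positive degree this is the forward direction of the
tree's `isDolbeaultHarmonic_iff_of_inner_tangentJ`; for functions (`k = 0`, where
`Δ_∂̄ f = ∂̄*∂̄f`) it is the printed argument `‖∂̄f‖² = ⟪f, ∂̄*∂̄f⟫ = ⟪f, 0⟫ = 0` (Lemma 5.8,
`MForm.cl2Inner_dolbeaultBar_left_of_isHermitian`, and positivity of the Hermitian `L²` product on
smooth forms, `eq_zero_of_cl2Inner_self_eq_zero`); on a `0`-dimensional `M` there are no `1`-forms.
[cite: Voisin2002, Cor. 5.13] -/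
theorem dolbeaultBar_eq_zero_of_isDolbeaultHarmonic_of_inner_tangentJ
    [RiemannianBundle (fun x : M ↦ TangentSpace 𝓘(ℝ, E) x)]
    [IsContinuousRiemannianBundle E (fun x : M ↦ TangentSpace 𝓘(ℝ, E) x)]
    [IsContMDiffRiemannianBundle 𝓘(ℝ, E) ∞ E (fun x : M ↦ TangentSpace 𝓘(ℝ, E) x)]
    [CompactSpace M] [T2Space M]
    (hJ : ∀ (x : M) (v w : TangentSpace 𝓘(ℝ, E) x),
      inner ℝ (tangentJ E x v) (tangentJ E x w) = inner ℝ v w)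
    (ho : IsSmoothForm (riemannianVolumeForm o)) {k p q m : ℕ} (h : k + m = n)
    {α : MForm 𝓘(ℝ, E) M ℂ k} (hH : IsDolbeaultHarmonic o p q h α) : dolbeaultBar α = 0 := by
  rcases k with - | k
  · -- functions: `Δ_∂̄ f = ∂̄*∂̄f` (or `0` when `n = 0`)
    obtain ⟨hs, -, hΔ⟩ := hH
    rcases m with - | m
    · exact cform_eq_zero_of_finrank_lt (n := n) (by omega) _
    · letI : MeasurableSpace E := borel E
      haveI : BorelSpace E := ⟨rfl⟩
      have h1 : (0 + 1) + m = n := by omega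
      have hΔ' : dolbeaultBarAdjoint o h1 (dolbeaultBar α) = 0 := hΔ
      -- `‖∂̄f‖² = ⟪f, ∂̄*∂̄f⟫ = 0`
      have key := MForm.cl2Inner_dolbeaultBar_left_of_isHermitian o hJ ho h1 hs hs.dolbeaultBar
      rw [hΔ', MForm.cl2Inner_zero_right] at key
      exact eq_zero_of_cl2Inner_self_eq_zero o ho (show (0 + 1) + m = n by omega)
        hs.dolbeaultBar key
  · exact ((isDolbeaultHarmonic_iff_of_inner_tangentJ o hJ ho h hH.1 hH.2.1).1 hH).1

/-- **A `Δ_∂̄`-harmonic form on a compact Hermitian manifold is `∂̄`-closed**, for the smooth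
metric term `g` (Hermitian, `hg`) installed as the Riemannian structure, every degree: the form in
which the C12 facts are phrased. Voisin (2002), Cor. 5.13; Huybrechts (2005), Lemma 3.2.5.
[cite: Voisin2002, Cor. 5.13] -/
theorem dolbeaultBar_eq_zero_of_isDolbeaultHarmonic [CompactSpace M] [T2Space M]
    (hg : g.toRiemannianMetric.IsHermitian) {k p q m : ℕ} (h : k + m = n)
    {α : MForm 𝓘(ℝ, E) M ℂ k} :
    letI : RiemannianBundle (fun x : M ↦ TangentSpace 𝓘(ℝ, E) x) := ⟨g.toRiemannianMetric⟩
    IsSmoothForm (riemannianVolumeForm o) → IsDolbeaultHarmonic o p q h α → dolbeaultBar α = 0 := by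
  letI : RiemannianBundle (fun x : M ↦ TangentSpace 𝓘(ℝ, E) x) := ⟨g.toRiemannianMetric⟩
  haveI : IsContMDiffRiemannianBundle 𝓘(ℝ, E) ∞ E (fun x : M ↦ TangentSpace 𝓘(ℝ, E) x) :=
    ⟨g.inner, g.contMDiff, fun _ _ _ ↦ rfl⟩
  haveI : IsContinuousRiemannianBundle E (fun x : M ↦ TangentSpace 𝓘(ℝ, E) x) :=
    ⟨g.inner, g.contMDiff.continuous, fun _ _ _ ↦ rfl⟩
  intro ho hH
  exact dolbeaultBar_eq_zero_of_isDolbeaultHarmonic_of_inner_tangentJ o (fun x v w ↦ hg x v w) ho h hH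

/-- **`ℋ^{p,q} ≤ Z^{p,q}_{∂̄}` on a compact Hermitian manifold — the C12 named fact
`dolbeaultHarmonicForms_le_dolbeaultClosedForms g o`, proved at a complex manifold.** For a
holomorphic atlas on `M` (the instance in the context here; the `Prop` itself, an M5 `def` of
`KaehlerHodge.lean`, does not bind it and is not claimed elsewhere), a smooth metric `g` which is
Hermitian and an orientation family with smooth volume form, the `ℂ`-span of the `∂̄`-harmonic
`(p,q)`-forms lies in the `ℂ`-span `Z^{p,q}_{∂̄}` of the smooth `∂̄`-closed `(p,q)`-forms: the
generators are smooth, of type `(p,q)` and `∂̄`-closed by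
`dolbeaultBar_eq_zero_of_isDolbeaultHarmonic` (`Submodule.span_mono`). Voisin (2002), §5.1.4,
Cor. 5.13 (PDF p. 108); Huybrechts (2005), Lemma 3.2.5. This discharges hypothesis `h₁` of the
relative discharges above. [cite: Voisin2002, Cor. 5.13] -/
theorem dolbeaultHarmonicForms_le_dolbeaultClosedForms_of_isManifold_complex {m : ℕ} :
    dolbeaultHarmonicForms_le_dolbeaultClosedForms (m := m) g o := by
  intro _ _ hg p q h ho
  letI : RiemannianBundle (fun x : M ↦ TangentSpace 𝓘(ℝ, E) x) := ⟨g.toRiemannianMetric⟩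
  exact Submodule.span_mono fun α (hH : IsDolbeaultHarmonic o p q h α) ↦
    ⟨hH.1, hH.2.1, dolbeaultBar_eq_zero_of_isDolbeaultHarmonic g o hg h ho hH⟩

/-- **`∂̄`-harmonic `(p,q)`-forms on a compact Kähler manifold are `d`-closed**, given only the
Kähler identity `Δ_∂̄ = Δ_∂` at this complex manifold (`hK`, the C12 `Prop`
`dolbeaultLaplacian_eq_delLaplacian g o` in every degree; Voisin (2002), Thm. 6.7):
`isClosedForm_of_mem_dolbeaultHarmonicForms` with `h₁` discharged by
`dolbeaultHarmonicForms_le_dolbeaultClosedForms_of_isManifold_complex` and `h₂` by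
`dolbeaultHarmonicForms_conj_of_dolbeaultLaplacian_eq_delLaplacian`. Voisin (2002), §6.1.2,
Cor. 6.10 with Cor. 5.13 (PDF pp. 108, 120–121). [cite: Voisin2002, Cor. 6.10] -/
theorem isClosedForm_of_mem_dolbeaultHarmonicForms_of_dolbeaultLaplacian_eq_delLaplacian
    [CompactSpace M] [T2Space M]
    (hK : ∀ {k m : ℕ}, dolbeaultLaplacian_eq_delLaplacian (k := k) (m := m) g o)
    (hg : g.toRiemannianMetric.IsKaehler) {k p q m : ℕ} (hk : p + q = k) (h : k + m = n)
    {α : MForm 𝓘(ℝ, E) M ℂ k} :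
    letI : RiemannianBundle (fun x : M ↦ TangentSpace 𝓘(ℝ, E) x) := ⟨g.toRiemannianMetric⟩
    IsSmoothForm (riemannianVolumeForm o) → α ∈ dolbeaultHarmonicForms o p q h →
      IsSmoothForm α ∧ IsOfType p q α ∧ IsClosedForm α :=
  isClosedForm_of_mem_dolbeaultHarmonicForms g o
    (fun {_} ↦ dolbeaultHarmonicForms_le_dolbeaultClosedForms_of_isManifold_complex g o)
    (fun {_ _} ↦ dolbeaultHarmonicForms_conj_of_dolbeaultLaplacian_eq_delLaplacian g o hK) hg hk h

end Closed

/-! ### The discharge, reduced to Voisin's Theorem 6.7 alone -/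

/-- **Reduced relative discharge of `mk_mem_hodgePQ_of_mem_dolbeaultHarmonicForms` via
`Δ_d = 2Δ_∂̄`.** On a compact Kähler manifold the de Rham class of a `∂̄`-harmonic `(p,q)`-form
lies in `hodgePQ E M k p q`, *given only* the Kähler identity `Δ_d = 2Δ_∂̄` on the smooth forms of
this complex manifold in every degree — hypothesis `hK`, the corrected C12 named fact
`cHodgeLaplacian_eq_two_smul_dolbeaultLaplacian_of_isManifold_complex g o` (Voisin (2002), Thm. 6.7;
not yet discharged in the tree), quantified under the holomorphic-atlas instance that the fact
being proved binds itself. Proof: after introducing that instance,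
`mk_mem_hodgePQ_of_mem_dolbeaultHarmonicForms_of_cHodgeLaplacian_eq_two_smul_dolbeaultLaplacian`
with `h₁ := dolbeaultHarmonicForms_le_dolbeaultClosedForms_of_isManifold_complex` (Voisin,
Cor. 5.13, proved above) and `hK` read through
`cHodgeLaplacian_eq_two_smul_dolbeaultLaplacian_of_isManifold_complex_iff`. The closed discharge
`mk_mem_hodgePQ_of_mem_dolbeaultHarmonicForms_holds` is this theorem fed the future
`cHodgeLaplacian_eq_two_smul_dolbeaultLaplacian_of_isManifold_complex_holds`. Voisin (2002),
§6.1.3, proof of Prop. 6.11 (PDF p. 121). [cite: Voisin2002, §6.1.3 Prop. 6.11] -/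
theorem mk_mem_hodgePQ_of_mem_dolbeaultHarmonicForms_of_laplacian_comparison
    (hK : ∀ [IsManifold 𝓘(ℂ, E) ω M] {k m : ℕ},
      cHodgeLaplacian_eq_two_smul_dolbeaultLaplacian_of_isManifold_complex (k := k) (m := m) g o) :
    mk_mem_hodgePQ_of_mem_dolbeaultHarmonicForms g o := by
  intro _ _ _ hg
  exact mk_mem_hodgePQ_of_mem_dolbeaultHarmonicForms_of_cHodgeLaplacian_eq_two_smul_dolbeaultLaplacian
    g o (fun {_} ↦ dolbeaultHarmonicForms_le_dolbeaultClosedForms_of_isManifold_complex g o)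
    (fun {k m} ↦ (cHodgeLaplacian_eq_two_smul_dolbeaultLaplacian_of_isManifold_complex_iff
      (k := k) (m := m) g o).1 hK) hg

/-- **Reduced relative discharge of `mk_mem_hodgePQ_of_mem_dolbeaultHarmonicForms` via
`Δ_∂̄ = Δ_∂`**: as `mk_mem_hodgePQ_of_mem_dolbeaultHarmonicForms_of_laplacian_comparison`, with the
corrected C12 named fact `dolbeaultLaplacian_eq_delLaplacian_of_isManifold_complex g o`
(`KaehlerHodgeDelLaplacianFact.lean`; Voisin (2002), Thm. 6.7; not yet discharged) as the only
hypothesis, through `dolbeaultLaplacian_eq_delLaplacian_of_isManifold_complex_iff` and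
`mk_mem_hodgePQ_of_mem_dolbeaultHarmonicForms_of_dolbeaultLaplacian_eq_delLaplacian`.
Voisin (2002), §6.1.3, proof of Prop. 6.11 (PDF p. 121). [cite: Voisin2002, §6.1.3 Prop. 6.11] -/
theorem mk_mem_hodgePQ_of_mem_dolbeaultHarmonicForms_of_dolbeaultLaplacian_eq_delLaplacian'
    (hK : ∀ [IsManifold 𝓘(ℂ, E) ω M] {k m : ℕ},
      dolbeaultLaplacian_eq_delLaplacian_of_isManifold_complex (k := k) (m := m) g o) :
    mk_mem_hodgePQ_of_mem_dolbeaultHarmonicForms g o := by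
  intro _ _ _ hg
  exact mk_mem_hodgePQ_of_mem_dolbeaultHarmonicForms_of_dolbeaultLaplacian_eq_delLaplacian
    g o (fun {_} ↦ dolbeaultHarmonicForms_le_dolbeaultClosedForms_of_isManifold_complex g o)
    (fun {k m} ↦ (dolbeaultLaplacian_eq_delLaplacian_of_isManifold_complex_iff
      (k := k) (m := m) g o).1 hK) hg

/-- **Reduced relative discharge of `mk_mem_hodgePQ_of_mem_dolbeaultHarmonicForms` from the
first-order Kähler identities** (Voisin (2002), Prop. 6.5: `[Λ, ∂̄] = -i∂*`, `[Λ, ∂] = i∂̄*` for the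
adjoint `Λ` of the Lefschetz operator of the Kähler metric). If, at this complex manifold and for
the metric `g` (Kähler, `hg`), *some* contraction family `Λ` satisfies the predicate
`KaehlerIdentities o Λ` of `KaehlerHodgeLaplacianProofs.lean` (hypothesis `hΛ`), then the fact
holds: `Δ_∂̄ = Δ_∂` follows (`dolbeaultLaplacian_eq_delLaplacian_of_kaehlerIdentities`, Huybrechts
(2005), Prop. 3.1.12 (ii) ⇒ (iii)), and then
`mk_mem_hodgePQ_of_mem_dolbeaultHarmonicForms_of_dolbeaultLaplacian_eq_delLaplacian'` applies. This
isolates exactly what is missing from the tree for the closed discharge: Voisin's Prop. 6.5 for the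
Kähler metric `g`. Voisin (2002), §6.1.1 Prop. 6.5, §6.1.2 Thm. 6.7, §6.1.3 Prop. 6.11.
[cite: Voisin2002, §6.1.3 Prop. 6.11] -/
theorem mk_mem_hodgePQ_of_mem_dolbeaultHarmonicForms_of_kaehlerIdentities
    (hΛ : ∀ [IsManifold 𝓘(ℂ, E) ω M], g.toRiemannianMetric.IsKaehler →
      letI : RiemannianBundle (fun x : M ↦ TangentSpace 𝓘(ℝ, E) x) := ⟨g.toRiemannianMetric⟩
      ∃ Λ : (j : ℕ) → MForm 𝓘(ℝ, E) M ℂ (j + 2) → MForm 𝓘(ℝ, E) M ℂ j, KaehlerIdentities o Λ) :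
    mk_mem_hodgePQ_of_mem_dolbeaultHarmonicForms g o := by
  intro _ _ _ hg
  obtain ⟨Λ, hKI⟩ := hΛ hg
  exact mk_mem_hodgePQ_of_mem_dolbeaultHarmonicForms_of_dolbeaultLaplacian_eq_delLaplacian
    g o (fun {_} ↦ dolbeaultHarmonicForms_le_dolbeaultClosedForms_of_isManifold_complex g o)
    (fun {k m} ↦ dolbeaultLaplacian_eq_delLaplacian_of_kaehlerIdentities (k := k) (m := m) g o hKI)
    hg

end Literature.AlgebraicGeometry.Motives

/-! ## The canonical comparison `H^{p,q} ≅ H^{p,q}_{∂̄}` reduced to three statements about the class map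
(D-0026 review of the named fact `exists_hodgePQ_equiv_dolbeaultCohomology`, 2026-08-15)

**Review verdict.** The named fact
`Literature.AlgebraicGeometry.Motives.exists_hodgePQ_equiv_dolbeaultCohomology` of
`HodgeDecomposition.lean` (hodge.S07, canonical comparison `K^{p,q} = H^{p,q} ≅ H^{p,q}_{∂̄}(M)`;
C. Voisin, *Hodge Theory and Complex Algebraic Geometry I* (2002), Lemma 6.18, p. 122: "`H^{p,q}(X)`
is canonically isomorphic to `H^q(X, Ω^p_X)`", proved there from the `Δ_d`-harmonic `(p,q)`-forms,
`Δ_d = 2Δ_∂̄` (Thm. 6.7) and the `∂̄`-Hodge theorem (Thm. 5.24), the canonical map being the one of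
Ch. 8 — a closed form of pure type `(p,q)` goes to its own Dolbeault class) was flagged as a
"decomposition child to be re-split". It is neither: it is the original D-0014 fact (the proposal
that last touched the file retyped `hω` elsewhere and declared nothing new), its elaborated binders
are `[FiniteDimensional ℂ E] [IsManifold 𝓘(ℝ, E) ∞ M]` with `[IsManifold 𝓘(ℂ, E) ω M] [CompactSpace M]
[T2Space M] [IsKaehlerManifold E M]` bound *inside* the `Prop` (so, unlike the section-`Hermitian`
facts of `KaehlerHodge.lean`, it is stated exactly for compact Kähler manifolds and needs no
restatement), and it has live consumers (`DeRhamComparisonProofs.lean`,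
`KaehlerHodgeSumHodgeNumberFact.lean`, `finrank_hodgePQ_eq_hodgeNumber`), so it is not merged away.
Its closed discharge is blocked only upstream, on three named facts that already exist in the tree
(none is restated here, D-0026): the `∂̄`-Hodge theorem `existsUnique_isDolbeaultHarmonic_mk_eq g o`
(Voisin, Thm. 5.24; a predicate, true at a complex manifold, cf. `finite_dolbeaultCohomology_of_hodgeTheory`),
the Kähler identity `cHodgeLaplacian_eq_two_smul_dolbeaultLaplacian_of_isManifold_complex g o`
(Voisin, Thm. 6.7) and the real Hodge theorem `existsUnique_isHarmonicForm_mk_eq_of_compact`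
(`Motives/HodgeTheorem.lean`; Warner, Thm. 6.11).

**What is proved here (pure linear algebra, no analysis, no new named fact).** Write
`S = {α ∈ Z^{p+q}(M; ℂ) | α of type (p,q)}`; every class in `hodgePQ E M (p+q) p q` is the de Rham
class of a member of `S` (`exists_mk_eq_of_mem_hodgePQ`), and a closed smooth `(p,q)`-form is
`∂̄`-closed (`mem_dolbeaultClosedForms_of_mem_cclosedSmoothForms`, from C10's
`mem_dolbeaultClosedForms_of_isOfType_of_isClosedForm`), so the Dolbeault class map
`f : S → H^{p,q}_{∂̄}(M)`, `α ↦ [α]_{∂̄}` is defined. Then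
`exists_equiv_dolbeaultCohomology_of_classMap`: **if** (B) `f` kills the `d`-exact members of `S`,
(I) `f α = 0` only for `d`-exact `α`, and (S) every Dolbeault class is `f α` for some `α ∈ S`, **then**
there is a `ℂ`-linear isomorphism `e : hodgePQ E M (p+q) p q ≃ₗ[ℂ] dolbeaultCohomology E M p q` with
`e [α] = [α]_{∂̄}` for every closed `(p,q)`-form `α` — the body of the named fact at `(p, q)` (`e [α]`
is `f` of any representative in `S`, well defined by (B), injective by (I), surjective by (S)).
Conversely (`classMap_of_exists_equiv_dolbeaultCohomology`) such an `e` forces (B), (I), (S), so the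
reduction is lossless, and `exists_hodgePQ_equiv_dolbeaultCohomology_of_classMap` restates it as a
relative discharge of the named fact. On a compact Kähler manifold (B), (I), (S) are Voisin's proof
of Prop. 6.11 / Lemma 6.18 (pp. 121–122): (S) a Dolbeault class has a `Δ_∂̄`-harmonic representative
(Thm. 5.24), which is `d`-closed of type `(p,q)` (`Δ_d = 2Δ_∂̄`, Cor. 5.13;
`isClosedForm_of_mem_dolbeaultHarmonicForms` above); (B) for `α ∈ S` `d`-exact, its `Δ_∂̄`-harmonic
Dolbeault representative `γ` is `Δ_d`-harmonic, hence `L²`-orthogonal to `dA` and to `∂̄A`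
(`MForm.cl2Inner_mextDeriv_left`, `MForm.cl2Inner_dolbeaultBar_left_of_isHermitian`), so
`‖γ‖² = ⟪γ, α⟫ - ⟪γ, α - γ⟫ = 0` and `α = α - γ ∈ B^{p,q}_{∂̄}`; (I) for `α ∈ S` `∂̄`-exact, the
`Δ_d`-harmonic representative of `[α]` (real Hodge theorem on `Re α`, `Im α`) is likewise orthogonal
to `∂̄A ∋ α` and to `dA`, hence `0`, so `α` is `d`-exact. These three steps are the remaining proof
obligation of the fact's prove-seat (inline lemmas from the three upstream facts); nothing else is
missing.

References: C. Voisin (2002), §6.1.3, Prop. 6.11 (p. 121), Lemma 6.18 (p. 122); D. Huybrechts,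
*Complex Geometry* (2005), Cor. 3.2.12 (p. 154). -/

namespace Literature.AlgebraicGeometry.Motives

open Literature.Geometry.Kaehler Literature.NumberTheory.Transcendental

section ClassMap

variable {E : Type*} [NormedAddCommGroup E] [NormedSpace ℂ E]
  {M : Type*} [TopologicalSpace M] [ChartedSpace E M] {p q : ℕ}

/-- **A closed smooth complex form of pure type `(p,q)` is `∂̄`-closed**, for members of the `ℂ`-span
`Z^{p+q}(M; ℂ) = cclosedSmoothForms` (which adds nothing: `mem_cclosedSmoothForms_iff`): C10's
`mem_dolbeaultClosedForms_of_isOfType_of_isClosedForm` fed the discharged `IsOfType.dolbeaultBar_eq_holds`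
(`∂̄α = (dα)^{p,q+1} = 0`). This is the map `K^{p,q} → H^{p,q}_{∂̄}` on representatives. Voisin (2002),
§2.3.3 and §6.1.3 (proof of Prop. 6.11, p. 121). [cite: Voisin2002, §6.1.3 Prop. 6.11] -/
theorem mem_dolbeaultClosedForms_of_mem_cclosedSmoothForms {α : MForm 𝓘(ℝ, E) M ℂ (p + q)}
    (hα : α ∈ cclosedSmoothForms E M (p + q)) (ht : IsOfType p q α) :
    α ∈ dolbeaultClosedForms E M p q :=
  mem_dolbeaultClosedForms_of_isOfType_of_isClosedForm IsOfType.dolbeaultBar_eq_holds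
    ((mem_cclosedSmoothForms_iff α).1 hα).1 ht ((mem_cclosedSmoothForms_iff α).1 hα).2

/-- The de Rham class of a closed smooth complex form vanishes iff the form is exact (C9's
`complexDeRhamCohomology.mk_eq_mk_iff` at `β = 0`). [folklore] -/
theorem complexDeRhamCohomology_mk_eq_zero_iff {k : ℕ} (α : cclosedSmoothForms E M k) :
    complexDeRhamCohomology.mk E M k α = 0 ↔
      (α : MForm 𝓘(ℝ, E) M ℂ k) ∈ cexactSmoothForms E M k := by
  rw [← (complexDeRhamCohomology.mk E M k).map_zero, complexDeRhamCohomology.mk_eq_mk_iff,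
    Submodule.coe_zero, sub_zero]

/-- The Dolbeault class of a `∂̄`-closed smooth `(p,q)`-form vanishes iff the form is `∂̄`-exact (C10's
`dolbeaultCohomology.mk_eq_mk_iff` at `β = 0`). [folklore] -/
theorem dolbeaultCohomology_mk_eq_zero_iff (α : dolbeaultClosedForms E M p q) :
    dolbeaultCohomology.mk E M p q α = 0 ↔
      (α : MForm 𝓘(ℝ, E) M ℂ (p + q)) ∈ dolbeaultExactForms E M p q := by
  rw [← (dolbeaultCohomology.mk E M p q).map_zero, dolbeaultCohomology.mk_eq_mk_iff,
    Submodule.coe_zero, sub_zero]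

/-- Every element of `H^{p,q} = hodgePQ E M (p+q) p q` (the `ℂ`-span of the classes of closed
`(p,q)`-forms) is the class of a single closed smooth form of type `(p,q)`: the closed `(p,q)`-forms
already form a subspace (`IsOfType.add`, `IsOfType.smul`) and the class map is linear. Voisin (2002),
§6.1.3 (the subspace `K^{p,q}`, proof of Prop. 6.11, p. 121). [cite: Voisin2002, §6.1.3 Prop. 6.11] -/
theorem exists_mk_eq_of_mem_hodgePQ {c : complexDeRhamCohomology E M (p + q)}
    (hc : c ∈ hodgePQ E M (p + q) p q) :
    ∃ α : cclosedSmoothForms E M (p + q), IsOfType p q (α : MForm 𝓘(ℝ, E) M ℂ (p + q)) ∧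
      complexDeRhamCohomology.mk E M (p + q) α = c := by
  induction hc using Submodule.span_induction with
  | mem y hy =>
    obtain ⟨α, hα, rfl⟩ := hy
    exact ⟨α, hα, rfl⟩
  | zero => exact ⟨0, isOfType_zero rfl, map_zero _⟩
  | add y z _ _ hy hz =>
    obtain ⟨α, hα, rfl⟩ := hy
    obtain ⟨β, hβ, rfl⟩ := hz
    exact ⟨α + β, hα.add hβ, map_add _ _ _⟩
  | smul a y _ hy =>
    obtain ⟨α, hα, rfl⟩ := hy
    exact ⟨a • α, hα.smul a, map_smul _ _ _⟩

/-- **The class map `K^{p,q} → H^{p,q}_{∂̄}` is well defined on classes iff it kills exact forms**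
(form used below): if the Dolbeault class map vanishes on the `d`-exact closed `(p,q)`-forms
(hypothesis `hB`), then two closed `(p,q)`-forms with the same de Rham class have the same Dolbeault
class (their difference is a `d`-exact closed `(p,q)`-form). Voisin (2002), §6.1.3, proof of
Prop. 6.11 (p. 121). [cite: Voisin2002, §6.1.3 Prop. 6.11] -/
theorem dolbeaultCohomology_mk_eq_of_complexDeRhamCohomology_mk_eq
    (hB : ∀ α : MForm 𝓘(ℝ, E) M ℂ (p + q), α ∈ cclosedSmoothForms E M (p + q) → IsOfType p q α →
      α ∈ cexactSmoothForms E M (p + q) → α ∈ dolbeaultExactForms E M p q)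
    {α β : cclosedSmoothForms E M (p + q)} (hα : IsOfType p q (α : MForm 𝓘(ℝ, E) M ℂ (p + q)))
    (hβ : IsOfType p q (β : MForm 𝓘(ℝ, E) M ℂ (p + q)))
    (h : complexDeRhamCohomology.mk E M (p + q) α = complexDeRhamCohomology.mk E M (p + q) β) :
    dolbeaultCohomology.mk E M p q ⟨α, mem_dolbeaultClosedForms_of_mem_cclosedSmoothForms α.2 hα⟩ =
      dolbeaultCohomology.mk E M p q ⟨β, mem_dolbeaultClosedForms_of_mem_cclosedSmoothForms β.2 hβ⟩ := by
  rw [complexDeRhamCohomology.mk_eq_mk_iff] at h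
  rw [dolbeaultCohomology.mk_eq_mk_iff]
  have ht : IsOfType p q ((α : MForm 𝓘(ℝ, E) M ℂ (p + q)) - (β : MForm 𝓘(ℝ, E) M ℂ (p + q))) := by
    rw [sub_eq_add_neg]
    exact hα.add hβ.neg
  exact hB _ (Submodule.sub_mem _ α.2 β.2) ht h

/-- **`H^{p,q} ≅ H^{p,q}_{∂̄}` from three properties of the class map.** Let `S ⊆ Z^{p+q}(M; ℂ)` be the
closed smooth forms of type `(p,q)` and `f : S → H^{p,q}_{∂̄}(M)`, `α ↦ [α]_{∂̄}`
(`mem_dolbeaultClosedForms_of_mem_cclosedSmoothForms`). If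
(B) `f` vanishes on the `d`-exact members of `S` (hypothesis `hB`),
(I) `f α = 0` implies that `α` is `d`-exact (`hI`), and
(S) every Dolbeault class is `[α]_{∂̄}` for some `α ∈ S` (`hS`),
then there is a `ℂ`-linear isomorphism `e : hodgePQ E M (p+q) p q ≃ₗ[ℂ] dolbeaultCohomology E M p q`
sending the de Rham class of every closed `(p,q)`-form to its Dolbeault class — the body of the named
fact `exists_hodgePQ_equiv_dolbeaultCohomology` at the bidegree `(p,q)`. Construction: every
`c ∈ hodgePQ` is `[α]` for some `α ∈ S` (`exists_mk_eq_of_mem_hodgePQ`); put `e c = [α]_{∂̄}`, well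
defined by (B) (`dolbeaultCohomology_mk_eq_of_complexDeRhamCohomology_mk_eq`), linear because the class
maps are, injective by (I), surjective by (S) (`LinearEquiv.ofBijective`). Pure linear algebra over
the definitions of C9/C10; on a compact Kähler manifold (B), (I), (S) are the content of Voisin (2002),
proof of Prop. 6.11 (p. 121) and Lemma 6.18 (p. 122). [cite: Voisin2002, Lemma 6.18] -/
theorem exists_equiv_dolbeaultCohomology_of_classMap
    (hB : ∀ α : MForm 𝓘(ℝ, E) M ℂ (p + q), α ∈ cclosedSmoothForms E M (p + q) → IsOfType p q α →
      α ∈ cexactSmoothForms E M (p + q) → α ∈ dolbeaultExactForms E M p q)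
    (hI : ∀ α : MForm 𝓘(ℝ, E) M ℂ (p + q), α ∈ cclosedSmoothForms E M (p + q) → IsOfType p q α →
      α ∈ dolbeaultExactForms E M p q → α ∈ cexactSmoothForms E M (p + q))
    (hS : ∀ c : dolbeaultCohomology E M p q, ∃ (α : cclosedSmoothForms E M (p + q))
      (_ : IsOfType p q (α : MForm 𝓘(ℝ, E) M ℂ (p + q)))
      (h : (α : MForm 𝓘(ℝ, E) M ℂ (p + q)) ∈ dolbeaultClosedForms E M p q),
      dolbeaultCohomology.mk E M p q ⟨α, h⟩ = c) :
    ∃ e : hodgePQ E M (p + q) p q ≃ₗ[ℂ] dolbeaultCohomology E M p q,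
      ∀ (α : cclosedSmoothForms E M (p + q)) (hα : IsOfType p q (α : MForm 𝓘(ℝ, E) M ℂ (p + q))),
        ∃ h : (α : MForm 𝓘(ℝ, E) M ℂ (p + q)) ∈ dolbeaultClosedForms E M p q,
          e ⟨complexDeRhamCohomology.mk E M (p + q) α, Submodule.subset_span ⟨α, hα, rfl⟩⟩ =
            dolbeaultCohomology.mk E M p q ⟨α, h⟩ := by
  classical
  -- choose a closed `(p,q)` representative of every class in `hodgePQ`
  have hrep : ∀ c : hodgePQ E M (p + q) p q, ∃ α : cclosedSmoothForms E M (p + q),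
      IsOfType p q (α : MForm 𝓘(ℝ, E) M ℂ (p + q)) ∧
        complexDeRhamCohomology.mk E M (p + q) α = c :=
    fun c ↦ exists_mk_eq_of_mem_hodgePQ c.2
  choose rep hrepT hrepmk using hrep
  -- the Dolbeault class of the chosen representative, and its independence of the choice (B)
  let f : hodgePQ E M (p + q) p q → dolbeaultCohomology E M p q := fun c ↦
    dolbeaultCohomology.mk E M p q
      ⟨rep c, mem_dolbeaultClosedForms_of_mem_cclosedSmoothForms (rep c).2 (hrepT c)⟩
  have hf : ∀ (c : hodgePQ E M (p + q) p q) (α : cclosedSmoothForms E M (p + q))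
      (hα : IsOfType p q (α : MForm 𝓘(ℝ, E) M ℂ (p + q))),
      complexDeRhamCohomology.mk E M (p + q) α = c →
        f c = dolbeaultCohomology.mk E M p q
          ⟨α, mem_dolbeaultClosedForms_of_mem_cclosedSmoothForms α.2 hα⟩ :=
    fun c α hα hc ↦ dolbeaultCohomology_mk_eq_of_complexDeRhamCohomology_mk_eq hB (hrepT c) hα
      ((hrepmk c).trans hc.symm)
  -- linearity
  have hadd : ∀ c d : hodgePQ E M (p + q) p q, f (c + d) = f c + f d := by
    intro c d
    rw [hf (c + d) (rep c + rep d) ((hrepT c).add (hrepT d))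
      (by rw [map_add, hrepmk, hrepmk, Submodule.coe_add])]
    exact map_add (dolbeaultCohomology.mk E M p q) ⟨_, _⟩ ⟨_, _⟩
  have hsmul : ∀ (a : ℂ) (c : hodgePQ E M (p + q) p q), f (a • c) = a • f c := by
    intro a c
    rw [hf (a • c) (a • rep c) ((hrepT c).smul a) (by rw [map_smul, hrepmk, Submodule.coe_smul])]
    exact map_smul (dolbeaultCohomology.mk E M p q) a ⟨_, _⟩
  let fₗ : hodgePQ E M (p + q) p q →ₗ[ℂ] dolbeaultCohomology E M p q :=
    { toFun := f, map_add' := hadd, map_smul' := hsmul }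
  have hfₗ : ∀ c, fₗ c = f c := fun _ ↦ rfl
  -- (I): injectivity
  have hinj : Function.Injective fₗ := by
    rw [injective_iff_map_eq_zero]
    intro c hc
    rw [hfₗ] at hc
    have hc' : ((rep c : cclosedSmoothForms E M (p + q)) : MForm 𝓘(ℝ, E) M ℂ (p + q)) ∈
        dolbeaultExactForms E M p q := (dolbeaultCohomology_mk_eq_zero_iff _).1 hc
    have h0 : complexDeRhamCohomology.mk E M (p + q) (rep c) = 0 :=
      (complexDeRhamCohomology_mk_eq_zero_iff _).2 (hI _ (rep c).2 (hrepT c) hc')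
    exact Subtype.ext ((hrepmk c).symm.trans h0)
  -- (S): surjectivity
  have hsurj : Function.Surjective fₗ := by
    intro x
    obtain ⟨α, ht, h, hx⟩ := hS x
    refine ⟨⟨complexDeRhamCohomology.mk E M (p + q) α, Submodule.subset_span ⟨α, ht, rfl⟩⟩, ?_⟩
    rw [hfₗ, hf _ α ht rfl]
    exact hx
  -- assemble and check the characterisation on representatives
  refine ⟨LinearEquiv.ofBijective fₗ ⟨hinj, hsurj⟩,
    fun α hα ↦ ⟨mem_dolbeaultClosedForms_of_mem_cclosedSmoothForms α.2 hα, ?_⟩⟩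
  rw [LinearEquiv.ofBijective_apply, hfₗ]
  exact hf _ α hα rfl

/-- **Converse of `exists_equiv_dolbeaultCohomology_of_classMap`: the reduction is lossless.** If some
`ℂ`-linear isomorphism `e : hodgePQ E M (p+q) p q ≃ₗ[ℂ] dolbeaultCohomology E M p q` sends the de Rham
class of every closed `(p,q)`-form to its Dolbeault class (the body of the named fact
`exists_hodgePQ_equiv_dolbeaultCohomology` at `(p,q)`), then the class map kills the `d`-exact closed
`(p,q)`-forms (B), detects `d`-exactness (I), and reaches every Dolbeault class (S). Elementary
(`exists_mk_eq_of_mem_hodgePQ`). Voisin (2002), §6.1.3 (`K^{p,q}`, proof of Prop. 6.11, p. 121).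
[cite: Voisin2002, §6.1.3 Prop. 6.11] -/
theorem classMap_of_exists_equiv_dolbeaultCohomology
    (he : ∃ e : hodgePQ E M (p + q) p q ≃ₗ[ℂ] dolbeaultCohomology E M p q,
      ∀ (α : cclosedSmoothForms E M (p + q)) (hα : IsOfType p q (α : MForm 𝓘(ℝ, E) M ℂ (p + q))),
        ∃ h : (α : MForm 𝓘(ℝ, E) M ℂ (p + q)) ∈ dolbeaultClosedForms E M p q,
          e ⟨complexDeRhamCohomology.mk E M (p + q) α, Submodule.subset_span ⟨α, hα, rfl⟩⟩ =
            dolbeaultCohomology.mk E M p q ⟨α, h⟩) :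
    (∀ α : MForm 𝓘(ℝ, E) M ℂ (p + q), α ∈ cclosedSmoothForms E M (p + q) → IsOfType p q α →
      α ∈ cexactSmoothForms E M (p + q) → α ∈ dolbeaultExactForms E M p q) ∧
    (∀ α : MForm 𝓘(ℝ, E) M ℂ (p + q), α ∈ cclosedSmoothForms E M (p + q) → IsOfType p q α →
      α ∈ dolbeaultExactForms E M p q → α ∈ cexactSmoothForms E M (p + q)) ∧
    (∀ c : dolbeaultCohomology E M p q, ∃ (α : cclosedSmoothForms E M (p + q))
      (_ : IsOfType p q (α : MForm 𝓘(ℝ, E) M ℂ (p + q)))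
      (h : (α : MForm 𝓘(ℝ, E) M ℂ (p + q)) ∈ dolbeaultClosedForms E M p q),
      dolbeaultCohomology.mk E M p q ⟨α, h⟩ = c) := by
  obtain ⟨e, he⟩ := he
  refine ⟨fun α hα ht hex ↦ ?_, fun α hα ht hdb ↦ ?_, fun c ↦ ?_⟩
  · -- (B): `[α] = 0`, so `[α]_∂̄ = e [α] = e 0 = 0`
    obtain ⟨h, hαe⟩ := he ⟨α, hα⟩ ht
    have h0 : ∀ hπ, (⟨complexDeRhamCohomology.mk E M (p + q) ⟨α, hα⟩, hπ⟩ :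
        hodgePQ E M (p + q) p q) = 0 := fun _ ↦
      Subtype.ext ((complexDeRhamCohomology_mk_eq_zero_iff ⟨α, hα⟩).2 hex)
    rw [h0, map_zero] at hαe
    exact (dolbeaultCohomology_mk_eq_zero_iff ⟨α, h⟩).1 hαe.symm
  · -- (I): `e [α] = [α]_∂̄ = 0`, so `[α] = 0`
    obtain ⟨h, hαe⟩ := he ⟨α, hα⟩ ht
    rw [(dolbeaultCohomology_mk_eq_zero_iff ⟨α, h⟩).2 hdb, LinearEquiv.map_eq_zero_iff] at hαe
    exact (complexDeRhamCohomology_mk_eq_zero_iff ⟨α, hα⟩).1 (congrArg Subtype.val hαe)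
  · -- (S): `c = e x`, and `x ∈ hodgePQ` is the class of one closed `(p,q)`-form
    obtain ⟨⟨x, hx⟩, rfl⟩ := e.surjective c
    obtain ⟨α, hα, rfl⟩ := exists_mk_eq_of_mem_hodgePQ hx
    obtain ⟨h, hαe⟩ := he α hα
    exact ⟨α, hα, h, hαe.symm⟩

/-- **Relative discharge of `exists_hodgePQ_equiv_dolbeaultCohomology` from the class map** (review
verdict, D-0026): the named fact follows, bidegree by bidegree, from the three statements (B), (I), (S)
of `exists_equiv_dolbeaultCohomology_of_classMap` on a compact Kähler manifold — which are Voisin's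
proof of Prop. 6.11 / Lemma 6.18 and are to be derived (inline, by the fact's prove-seat) from the
existing named facts `existsUnique_isDolbeaultHarmonic_mk_eq g o` (Thm. 5.24),
`cHodgeLaplacian_eq_two_smul_dolbeaultLaplacian_of_isManifold_complex g o` (Thm. 6.7) and
`existsUnique_isHarmonicForm_mk_eq_of_compact` (Warner, Thm. 6.11), cf. the section docstring. The
hypotheses are stated under the instances the fact itself binds. Voisin (2002), Lemma 6.18 (p. 122).
[cite: Voisin2002, Lemma 6.18] -/
theorem exists_hodgePQ_equiv_dolbeaultCohomology_of_classMap [FiniteDimensional ℂ E]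
    [IsManifold 𝓘(ℝ, E) ∞ M]
    (hB : ∀ [IsManifold 𝓘(ℂ, E) ω M] [CompactSpace M] [T2Space M] [IsKaehlerManifold E M] (p q : ℕ)
      (α : MForm 𝓘(ℝ, E) M ℂ (p + q)), α ∈ cclosedSmoothForms E M (p + q) → IsOfType p q α →
      α ∈ cexactSmoothForms E M (p + q) → α ∈ dolbeaultExactForms E M p q)
    (hI : ∀ [IsManifold 𝓘(ℂ, E) ω M] [CompactSpace M] [T2Space M] [IsKaehlerManifold E M] (p q : ℕ)
      (α : MForm 𝓘(ℝ, E) M ℂ (p + q)), α ∈ cclosedSmoothForms E M (p + q) → IsOfType p q α →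
      α ∈ dolbeaultExactForms E M p q → α ∈ cexactSmoothForms E M (p + q))
    (hS : ∀ [IsManifold 𝓘(ℂ, E) ω M] [CompactSpace M] [T2Space M] [IsKaehlerManifold E M] (p q : ℕ)
      (c : dolbeaultCohomology E M p q), ∃ (α : cclosedSmoothForms E M (p + q))
      (_ : IsOfType p q (α : MForm 𝓘(ℝ, E) M ℂ (p + q)))
      (h : (α : MForm 𝓘(ℝ, E) M ℂ (p + q)) ∈ dolbeaultClosedForms E M p q),
      dolbeaultCohomology.mk E M p q ⟨α, h⟩ = c) :
    exists_hodgePQ_equiv_dolbeaultCohomology (E := E) (M := M) := by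
  intro _ _ _ _ p q
  exact exists_equiv_dolbeaultCohomology_of_classMap (hB p q) (hI p q) (hS p q)

end ClassMap

end Literature.AlgebraicGeometry.Motives
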